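import Summits.ValiantsHypothesis.ValiantsHypothesis.Theorems.SymPencilPerFourHyperplaneQuad

/-!
# Route `SymPencil` — the RESTRICTED QUAD LEMMA for `per [v; ·]`
# (tool file for the one-row defect-2 cell `(12,4,2)` of `sdc(per_4)`, `--supports`
# stmt-ValiantsHypothesis-5674; nothing here bears on `VP ≠ VNP`)

`T(a,b,c) = per [v; a; b; c]` (all `v_j ≠ 0`, characteristic `0`).  The tree's `eq_zero_of_perm_quad`:
`T(Y y, y, z) = 0` for all `y, z` forces `Y = 0`.  Here the test vector `z` is only allowed in a
HYPERPLANE: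

* **`eq_zero_of_perm_quad_restricted`** — if `T(Y y, y, z) = 0` for all `y` and all `z ∈ ker μ`
  (`μ` any linear form), then `Y = 0`.
* **`eq_zero_of_perm_quad_mul`** — if `T(Y y, y, z) = μ(z) · r(y)` for all `y, z` (any function `r`),
  then `Y = 0`.

Companion of `SymPencilPerFourHyperplaneQuad` (there the vector `y` is restricted; its small evaluation helpers are reused); together they are
the «hyperplane variants of the pair lemma» for the off-diagonal blocks of an exact flow symmetry of
`F_v` on a hyperplane whose linear form misses a row (val-width-5674-w2 g2's (RIG), cell `(12,4,2)`).
Proof: pivot `i` with `μ(e_i) ≠ 0`, basis `g_q = e_q − c_q e_i` of `ker μ`; `y = e_i` gives `Y e_i ∈ K e_i`;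
the polarised identity at `(e_i, e_p, g_p)` gives `v_a (Y e_p)_b + v_b (Y e_p)_a = 0`, whence every
`Y e_p` is diagonal, and the remaining pair identities force the diagonal to vanish — no case analysis.

Elementary; no definitions, no named facts. [folklore]
-/

noncomputable section

-- single-conjunct layout: Sub = Summit, duplicated namespace component intended
set_option linter.dupNamespace false

namespace Summit.ValiantsHypothesis.ValiantsHypothesis.Theorems.SymPencilPerFourRestrictedQuad

open Matrix
open Summit.ValiantsHypothesis.ValiantsHypothesis.Theorems.SymPencilPerFourInnerRankRows
open Summit.ValiantsHypothesis.ValiantsHypothesis.Theorems.SymPencilPerFourRowForms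
open Summit.ValiantsHypothesis.ValiantsHypothesis.Theorems.SymPencilPerFourRowStabilizer

variable {K : Type*} [Field K]

/-! ### Evaluations with the test vector `g = e_q - c e_i` -/

/-- Linearity of `per [v; w; y; ·]` at `e_q - c e_i`. [folklore] -/
theorem permanent_rows_sub_smul₃ (v w y : Fin 4 → K) (q i : Fin 4) (c : K) :
    (Matrix.of ![v, w, y, Pi.single q 1 - c • Pi.single i 1]).permanent =
      (Matrix.of ![v, w, y, Pi.single q 1]).permanent - c * (Matrix.of ![v, w, y, Pi.single i 1]).permanent := by
  simp only [permanent_of_rows, Pi.sub_apply, Pi.smul_apply, smul_eq_mul]; ring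

/-- `T(w, e_i, e_q − c e_i) = v_a w_b + v_b w_a` (`{i,q,a,b} = {0,1,2,3}`). [folklore] -/
theorem perm_g_row_i (v w : Fin 4 → K) (i q a b : Fin 4)
    (h : i ≠ q ∧ i ≠ a ∧ i ≠ b ∧ q ≠ a ∧ q ≠ b ∧ a ≠ b) (c : K) :
    (Matrix.of ![v, w, Pi.single i 1, Pi.single q 1 - c • Pi.single i 1]).permanent = v a * w b + v b * w a := by
  obtain ⟨hiq, hia, hib, hqa, hqb, hab⟩ := h
  rw [permanent_rows_sub_smul₃, SymPencilPerFourHyperplaneQuad.permanent_rows_w_single_single,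
    permanent_rows_single_single v w a i q b ⟨hia.symm, hqa.symm, hab, hiq, hib, hqb⟩]
  ring

/-- `T(w, e_p, e_p − c e_i) = −c (v_a w_b + v_b w_a)` (`{i,p,a,b} = {0,1,2,3}`). [folklore] -/
theorem perm_g_diag (v w : Fin 4 → K) (i p a b : Fin 4)
    (h : i ≠ p ∧ i ≠ a ∧ i ≠ b ∧ p ≠ a ∧ p ≠ b ∧ a ≠ b) (c : K) :
    (Matrix.of ![v, w, Pi.single p 1, Pi.single p 1 - c • Pi.single i 1]).permanent = -c * (v a * w b + v b * w a) := by
  obtain ⟨hip, hia, hib, hpa, hpb, hab⟩ := h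
  rw [permanent_rows_sub_smul₃, SymPencilPerFourHyperplaneQuad.permanent_rows_w_single_single,
    permanent_rows_single_single v w a p i b ⟨hpa.symm, hia.symm, hab, hip.symm, hpb, hib⟩]
  ring

/-- `T(w, e_p, e_a − c e_i) = (v_i w_b + v_b w_i) − c (v_a w_b + v_b w_a)` (`{i,p,a,b} = {0,1,2,3}`). [folklore] -/
theorem perm_g_off (v w : Fin 4 → K) (i p a b : Fin 4)
    (h : i ≠ p ∧ i ≠ a ∧ i ≠ b ∧ p ≠ a ∧ p ≠ b ∧ a ≠ b) (c : K) :
    (Matrix.of ![v, w, Pi.single p 1, Pi.single a 1 - c • Pi.single i 1]).permanent =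
      (v i * w b + v b * w i) - c * (v a * w b + v b * w a) := by
  obtain ⟨hip, hia, hib, hpa, hpb, hab⟩ := h
  rw [permanent_rows_sub_smul₃,
    permanent_rows_single_single v w i p a b ⟨hip, hia, hib, hpa, hpb, hab⟩,
    permanent_rows_single_single v w a p i b ⟨hpa.symm, hia.symm, hab, hip.symm, hpb, hib⟩]

/-- `T(e_i, e_p, e_a − c e_i) = v_b` and `T(e_i, e_p, e_p − c e_i) = 0` packaged: `T(e_p, e_p', e_r − c e_i) = v_i − c v_r`
for `{i,p,p',r} = {0,1,2,3}`. [folklore] -/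
theorem perm_g_two_single (v : Fin 4 → K) (i p p' r : Fin 4)
    (h : i ≠ p ∧ i ≠ p' ∧ i ≠ r ∧ p ≠ p' ∧ p ≠ r ∧ p' ≠ r) (c : K) :
    (Matrix.of ![v, Pi.single p 1, Pi.single p' 1, Pi.single r 1 - c • Pi.single i 1]).permanent = v i - c * v r := by
  obtain ⟨hip, hip', hir, hpp', hpr, hp'r⟩ := h
  rw [permanent_rows_sub_smul₃, permanent_rows_three_single v p p' r i ⟨hpp', hpr, hip.symm, hp'r, hip'.symm, hir.symm⟩,
    permanent_rows_three_single v p p' i r ⟨hpp', hip.symm, hpr, hip'.symm, hp'r, hir⟩]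

/-! ### The restricted quad lemma -/

/-- **Core (pivot form).** [folklore] -/
theorem eq_zero_of_perm_quad_restricted_aux [CharZero K] {v : Fin 4 → K} (hv : ∀ j, v j ≠ 0)
    (i k l m : Fin 4) (hd : i ≠ k ∧ i ≠ l ∧ i ≠ m ∧ k ≠ l ∧ k ≠ m ∧ l ≠ m)
    (hcov : ∀ j : Fin 4, j = i ∨ j = k ∨ j = l ∨ j = m)
    (Y : (Fin 4 → K) →ₗ[K] (Fin 4 → K)) (mu : (Fin 4 → K) →ₗ[K] K) (hmi : mu (Pi.single i 1) ≠ 0)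
    (h : ∀ y z : Fin 4 → K, mu z = 0 → (Matrix.of ![v, Y y, y, z]).permanent = 0) :
    Y = 0 := by
  classical
  obtain ⟨hik, hil, him, hkl, hkm, hlm⟩ := hd
  set c : Fin 4 → K := fun q => mu (Pi.single q 1) / mu (Pi.single i 1) with hc
  set g : Fin 4 → (Fin 4 → K) := fun q => Pi.single q 1 - c q • Pi.single i 1 with hg
  have hgker : ∀ q, mu (g q) = 0 := by
    intro q
    have h1 : c q * mu (Pi.single i 1) = mu (Pi.single q 1) := div_mul_cancel₀ _ hmi
    simp only [hg, map_sub, map_smul, smul_eq_mul, h1, sub_self]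
  -- polarisation in `y`
  have hpol : ∀ y y' z : Fin 4 → K, mu z = 0 →
      (Matrix.of ![v, Y y, y', z]).permanent + (Matrix.of ![v, Y y', y, z]).permanent = 0 := by
    intro y y' z hz
    have h1 := h (y + y') z hz
    have h2 := h y z hz
    have h3 := h y' z hz
    rw [map_add, per_add_row₁, per_add_row₂, per_add_row₂] at h1
    linear_combination h1 - h2 - h3
  -- Step 1: `Y e_i` is a multiple of `e_i`
  have hYi : ∀ q a b : Fin 4, i ≠ q ∧ i ≠ a ∧ i ≠ b ∧ q ≠ a ∧ q ≠ b ∧ a ≠ b →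
      v a * Y (Pi.single i 1) b + v b * Y (Pi.single i 1) a = 0 := by
    intro q a b hd'
    have h1 := h (Pi.single i 1) (g q) (hgker q)
    rwa [show g q = Pi.single q 1 - c q • Pi.single i 1 from rfl, perm_g_row_i v _ i q a b hd' (c q)] at h1
  have hYi0 : ∀ p a b : Fin 4, i ≠ p ∧ i ≠ a ∧ i ≠ b ∧ p ≠ a ∧ p ≠ b ∧ a ≠ b → Y (Pi.single i 1) p = 0 := by
    intro p a b ⟨hip, hia, hib, hpa, hpb, hab⟩
    have e1 := hYi p a b ⟨hip, hia, hib, hpa, hpb, hab⟩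
    have e2 := hYi a p b ⟨hia, hip, hib, hpa.symm, hab, hpb⟩
    have e3 := hYi b p a ⟨hib, hip, hia, hpb.symm, hab.symm, hpa⟩
    have h2 : 2 * v a * v b * Y (Pi.single i 1) p = 0 := by linear_combination v b * e3 + v a * e2 - v p * e1
    exact (mul_eq_zero.1 h2).resolve_left (mul_ne_zero (mul_ne_zero two_ne_zero (hv a)) (hv b))
  -- Step 2: every `Y e_p` (`p ≠ i`) is a multiple of `e_p`
  have hYp : ∀ p a b : Fin 4, i ≠ p ∧ i ≠ a ∧ i ≠ b ∧ p ≠ a ∧ p ≠ b ∧ a ≠ b →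
      Y (Pi.single p 1) i = 0 ∧ Y (Pi.single p 1) a = 0 ∧ Y (Pi.single p 1) b = 0 := by
    intro p a b ⟨hip, hia, hib, hpa, hpb, hab⟩
    -- `A_p = v_a w_b + v_b w_a = 0` from the pair `(i, p)` at `g_p`
    have hA : v a * Y (Pi.single p 1) b + v b * Y (Pi.single p 1) a = 0 := by
      have h1 := hpol (Pi.single i 1) (Pi.single p 1) (g p) (hgker p)
      rw [show g p = Pi.single p 1 - c p • Pi.single i 1 from rfl,
        perm_g_diag v _ i p a b ⟨hip, hia, hib, hpa, hpb, hab⟩ (c p),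
        perm_g_row_i v _ i p a b ⟨hip, hia, hib, hpa, hpb, hab⟩ (c p),
        hYi0 a p b ⟨hia, hip, hib, hpa.symm, hab, hpb⟩, hYi0 b p a ⟨hib, hip, hia, hpb.symm, hab.symm, hpa⟩] at h1
      linear_combination h1
    -- the diagonal relations at `g_a`, `g_b`
    have Ea := h (Pi.single p 1) (g a) (hgker a)
    have Eb := h (Pi.single p 1) (g b) (hgker b)
    rw [show g a = Pi.single a 1 - c a • Pi.single i 1 from rfl,
      perm_g_off v _ i p a b ⟨hip, hia, hib, hpa, hpb, hab⟩ (c a)] at Ea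
    rw [show g b = Pi.single b 1 - c b • Pi.single i 1 from rfl,
      perm_g_off v _ i p b a ⟨hip, hib, hia, hpb, hpa, hab.symm⟩ (c b)] at Eb
    have h2 : 2 * v a * v b * Y (Pi.single p 1) i = 0 := by
      linear_combination v a * Ea + v b * Eb - (v i - c a * v a - c b * v b) * hA
    have hwi : Y (Pi.single p 1) i = 0 :=
      (mul_eq_zero.1 h2).resolve_left (mul_ne_zero (mul_ne_zero two_ne_zero (hv a)) (hv b))
    have hwb : Y (Pi.single p 1) b = 0 := by
      have h3 : v i * Y (Pi.single p 1) b = 0 := by linear_combination Ea - v b * hwi + c a * hA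
      exact (mul_eq_zero.1 h3).resolve_left (hv i)
    have hwa : Y (Pi.single p 1) a = 0 := by
      have h3 : v i * Y (Pi.single p 1) a = 0 := by linear_combination Eb - v a * hwi + c b * hA
      exact (mul_eq_zero.1 h3).resolve_left (hv i)
    exact ⟨hwi, hwa, hwb⟩
  -- Step 3: the diagonal entries
  have hdiag_ip : ∀ p a b : Fin 4, i ≠ p ∧ i ≠ a ∧ i ≠ b ∧ p ≠ a ∧ p ≠ b ∧ a ≠ b →
      Y (Pi.single i 1) i + Y (Pi.single p 1) p = 0 := by
    intro p a b ⟨hip, hia, hib, hpa, hpb, hab⟩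
    have h1 := hpol (Pi.single i 1) (Pi.single p 1) (g a) (hgker a)
    obtain ⟨hwi, hwa, hwb⟩ := hYp p a b ⟨hip, hia, hib, hpa, hpb, hab⟩
    rw [show g a = Pi.single a 1 - c a • Pi.single i 1 from rfl,
      perm_g_off v _ i p a b ⟨hip, hia, hib, hpa, hpb, hab⟩ (c a),
      perm_g_row_i v _ i a p b ⟨hia, hip, hib, hpa.symm, hab, hpb⟩ (c a),
      hYi0 b p a ⟨hib, hip, hia, hpb.symm, hab.symm, hpa⟩, hYi0 a p b ⟨hia, hip, hib, hpa.symm, hab, hpb⟩, hwb] at h1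
    have h2 : v b * (Y (Pi.single i 1) i + Y (Pi.single p 1) p) = 0 := by linear_combination h1
    exact (mul_eq_zero.1 h2).resolve_left (hv b)
  have hdiag_pp : ∀ p p' r : Fin 4, i ≠ p ∧ i ≠ p' ∧ i ≠ r ∧ p ≠ p' ∧ p ≠ r ∧ p' ≠ r →
      c p * (Y (Pi.single p 1) p + Y (Pi.single p' 1) p') = 0 ∧
        (v i - c r * v r) * (Y (Pi.single p 1) p + Y (Pi.single p' 1) p') = 0 := by
    intro p p' r ⟨hip, hip', hir, hpp', hpr, hp'r⟩
    obtain ⟨hpi, hpp'0, hpr0⟩ := hYp p p' r ⟨hip, hip', hir, hpp', hpr, hp'r⟩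
    obtain ⟨hp'i, hp'p0, hp'r0⟩ := hYp p' p r ⟨hip', hip, hir, hpp'.symm, hp'r, hpr⟩
    constructor
    · have h1 := hpol (Pi.single p 1) (Pi.single p' 1) (g p) (hgker p)
      rw [show g p = Pi.single p 1 - c p • Pi.single i 1 from rfl,
        perm_g_off v _ i p' p r ⟨hip', hip, hir, hpp'.symm, hp'r, hpr⟩ (c p),
        perm_g_diag v _ i p p' r ⟨hip, hip', hir, hpp', hpr, hp'r⟩ (c p), hpr0, hpi, hp'r0] at h1
      have h2 : v r * (c p * (Y (Pi.single p 1) p + Y (Pi.single p' 1) p')) = 0 := by linear_combination -h1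
      exact (mul_eq_zero.1 h2).resolve_left (hv r)
    · have h1 := hpol (Pi.single p 1) (Pi.single p' 1) (g r) (hgker r)
      rw [show g r = Pi.single r 1 - c r • Pi.single i 1 from rfl,
        perm_g_off v _ i p' r p ⟨hip', hir, hip, hp'r, hpp'.symm, hpr.symm⟩ (c r),
        perm_g_off v _ i p r p' ⟨hip, hir, hip', hpr, hpp', hp'r.symm⟩ (c r), hpi, hpr0, hp'i, hp'r0] at h1
      linear_combination h1
  -- conclusion: all diagonal entries vanish
  have hk := hdiag_ip k l m ⟨hik, hil, him, hkl, hkm, hlm⟩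
  have hl := hdiag_ip l k m ⟨hil, hik, him, hkl.symm, hlm, hkm⟩
  have hm := hdiag_ip m k l ⟨him, hik, hil, hkm.symm, hlm.symm, hkl⟩
  obtain ⟨h1, h2⟩ := hdiag_pp k l m ⟨hik, hil, him, hkl, hkm, hlm⟩
  obtain ⟨h3, -⟩ := hdiag_pp m k l ⟨him, hik, hil, hkm.symm, hlm.symm, hkl⟩
  have hηi : Y (Pi.single i 1) i = 0 := by
    have h4 : v i * (2 * Y (Pi.single i 1) i) = 0 := by
      linear_combination -h2 - v m * h3 + (v i - c m * v m) * (hk + hl) + c m * v m * (hm + hk)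
    have h5 := (mul_eq_zero.1 h4).resolve_left (hv i)
    exact (mul_eq_zero.1 h5).resolve_left two_ne_zero
  have hηk : Y (Pi.single k 1) k = 0 := by linear_combination hk - hηi
  have hηl : Y (Pi.single l 1) l = 0 := by linear_combination hl - hηi
  have hηm : Y (Pi.single m 1) m = 0 := by linear_combination hm - hηi
  -- every `Y e_j` vanishes
  have hYe : ∀ j, Y (Pi.single j 1) = 0 := by
    have hI : Y (Pi.single i 1) = 0 := by
      have b1 := hYi0 k l m ⟨hik, hil, him, hkl, hkm, hlm⟩
      have b2 := hYi0 l k m ⟨hil, hik, him, hkl.symm, hlm, hkm⟩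
      have b3 := hYi0 m k l ⟨him, hik, hil, hkm.symm, hlm.symm, hkl⟩
      funext j
      rcases hcov j with rfl | rfl | rfl | rfl
      exacts [hηi, b1, b2, b3]
    have hK : Y (Pi.single k 1) = 0 := by
      obtain ⟨a1, a2, a3⟩ := hYp k l m ⟨hik, hil, him, hkl, hkm, hlm⟩
      funext j
      rcases hcov j with rfl | rfl | rfl | rfl
      exacts [a1, hηk, a2, a3]
    have hL : Y (Pi.single l 1) = 0 := by
      obtain ⟨a1, a2, a3⟩ := hYp l k m ⟨hil, hik, him, hkl.symm, hlm, hkm⟩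
      funext j
      rcases hcov j with rfl | rfl | rfl | rfl
      exacts [a1, a2, hηl, a3]
    have hM : Y (Pi.single m 1) = 0 := by
      obtain ⟨a1, a2, a3⟩ := hYp m k l ⟨him, hik, hil, hkm.symm, hlm.symm, hkl⟩
      funext j
      rcases hcov j with rfl | rfl | rfl | rfl
      exacts [a1, a2, a3, hηm]
    intro j
    rcases hcov j with rfl | rfl | rfl | rfl
    exacts [hI, hK, hL, hM]
  refine (Pi.basisFun K (Fin 4)).ext fun j => ?_
  rw [Pi.basisFun_apply, LinearMap.zero_apply]
  exact hYe j

/-- **The restricted quad lemma.**  If `per [v; Y y; y; z] = 0` for all `y` and all `z ∈ ker μ` (all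
`v_j ≠ 0`, characteristic `0`), then `Y = 0`.  For `μ = 0` this is `eq_zero_of_perm_quad`. [folklore] -/
theorem eq_zero_of_perm_quad_restricted [CharZero K] {v : Fin 4 → K} (hv : ∀ j, v j ≠ 0)
    (Y : (Fin 4 → K) →ₗ[K] (Fin 4 → K)) (mu : (Fin 4 → K) →ₗ[K] K)
    (h : ∀ y z : Fin 4 → K, mu z = 0 → (Matrix.of ![v, Y y, y, z]).permanent = 0) : Y = 0 := by
  classical
  by_cases hmu : mu = 0
  · exact eq_zero_of_perm_quad hv Y fun y z => h y z (by rw [hmu, LinearMap.zero_apply])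
  · obtain ⟨i, hmi⟩ : ∃ i, mu (Pi.single i 1) ≠ 0 := by
      by_contra h0
      push Not at h0
      exact hmu ((Pi.basisFun K (Fin 4)).ext fun i => by rw [Pi.basisFun_apply, LinearMap.zero_apply, h0 i])
    obtain ⟨k, l, m, hd, hcov⟩ := SymPencilPerFourHyperplaneQuad.exists_three_compl_cover i
    exact eq_zero_of_perm_quad_restricted_aux hv i k l m hd hcov Y mu hmi h

/-- **The restricted quad lemma (product form).**  If `per [v; Y y; y; z] = μ(z) · r(y)` for all
`y, z` (any function `r`), then `Y = 0`. [folklore] -/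
theorem eq_zero_of_perm_quad_mul [CharZero K] {v : Fin 4 → K} (hv : ∀ j, v j ≠ 0)
    (Y : (Fin 4 → K) →ₗ[K] (Fin 4 → K)) (mu : (Fin 4 → K) →ₗ[K] K) (r : (Fin 4 → K) → K)
    (h : ∀ y z : Fin 4 → K, (Matrix.of ![v, Y y, y, z]).permanent = mu z * r y) : Y = 0 :=
  eq_zero_of_perm_quad_restricted hv Y mu fun y z hz => by rw [h y z, hz, zero_mul]

end Summit.ValiantsHypothesis.ValiantsHypothesis.Theorems.SymPencilPerFourRestrictedQuad

end
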